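import Summits.FinalStateConjecture.FinalStateConjecture.Theorems.SwallowTheDatumParametricKerrBurialReduction
import Literature.Geometry.Lorentzian.ObstructionFreeGluing
import Literature.Geometry.Lorentzian.InitialDataLocality
import Literature.Geometry.Lorentzian.ModelData

/-!
# Engine vocabulary of the line `receding-annulus-universal-collar`, skeleton v5 (crux `SwallowTheDatum.ParametricKerrBurial`,
# item stmt-FinalStateConjecture-10052) — definitions, plus two elementary lemmas (`exists_isBump`, `mot_apply`)

Lead prover-line-stmt-FinalStateConjecture-10052-1 (gen 1), 2026-08-16.  The crux is reduced in the tree to (A) `stub_farGluing`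
and (B) `stub_collarDatum` (`ParametricKerrBurial_of_farGluing_of_collarDatum`, p92199).  This file fixes the statements through
which both are attacked with ONE printed gluing theorem — Mao–Oh–Tao arXiv:2308.13031 Thm 1.7, vendored as
`Literature.Geometry.Lorentzian.MaoOhTao.ObstructionFreeAnnularGluing` — applied at weak field only:

* §1 `MOTHyp` — the hypothesis block of Thm 1.7 for a pair of in/out coefficient fields (so that explicit-field lemmas and
  the applications speak the same language), and `GluingFamilyFor η` — the theorem with `C^∞` dependence on a real parameter
  of the in-data (UNPRINTED: Rem 1.9 prints local Lipschitz dependence; `∀ η, IsBump η → GluingFamilyFor η` is the one unprinted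
  atom of the line, posited by the route, never to be dressed as literature);
* §2 the plumbing predicates `ReadTransplantAt` (affine reading `y ↦ c + s y` of a datum on `ℝ³` and transplanting a unit-scale
  datum back) and `CapEndAt` (reading through the sheet-2 inversion `x ↦ (ρ₃/|x|²) x` — an isometry of isotropic
  Schwarzschild — and transplanting the glued end back);
* §3 the explicit-field predicates `FlatVacuumDatum`, `SchwDatum`, `SchwOutSite` (charges and deviation of the exact isotropic
  Schwarzschild far field as OUT-data against nearly flat IN-data) and `BulkAt` (the Brill–Lindquist bulk `(A + Σ α_j/|y − y_j|)⁴ δ`: vacuum off the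
  punctures, every puncture an admissible OUT-site against a flat core — the central one against a Schwarzschild(`μ′/64`)
  core — and the inverted reading an admissible OUT-site against the sheet-2 far field of Schwarzschild(`M`));
* §4 `PlugDataPlusAt μ₀` — the sibling crux's PlugData (10055) with an exact Schwarzschild(`λμ`) annulus `{λ < |y| < 2λ`}.

All statements are PREDICATES (with parameters) — deliberately: parameterless `Prop`s in a Theorems file are named facts and belong
to Literature; these are route-internal interfaces.  Skeleton v5 (crux dir `Lines/receding-annulus-universal-collar.lean`) composes:
(B) ⟸ PlugData⁺ ⟸ MOT ∧ readings ∧ CapEnd ∧ Schwarzschild site ∧ bulk; (A) is delegated to the parallel lead c1's registered stubs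
(`stub_unitAnnulusGluing` — which `∀ η, IsBump η → GluingFamilyFor η` plus `SchwOutSite` would prove —, `stub_endRescaling`,
`stub_farGluing_of_unitGluing`).  References: Mao–Oh–Tao arXiv:2308.13031 Thm 1.7,
Rem 1.9, Rem 1.11; Brill–Lindquist, Phys. Rev. 131 (1963) 471; the crux directory's `PICKED.md`.
-/

set_option linter.dupNamespace false

noncomputable section

namespace Summit.FinalStateConjecture.FinalStateConjecture.Theorems.SwallowTheDatum.ParametricKerrBurial

open scoped Manifold ContDiff Topology BigOperators InnerProductSpace
open Bundle Set Filter Function MeasureTheory Literature.Geometry.Lorentzian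
open Literature.Geometry.Lorentzian.MaoOhTao Literature.Geometry.Lorentzian.InitialDataSet

/-! ## §0 A bump exists -/

/-- There is an admissible radial bump `η` (`C^∞`, `supp η ⊆ [1,2]`, `∫ η = 1`): normalise the product of two smooth
transitions. [folklore] -/
theorem exists_isBump : ∃ η : ℝ → ℝ, IsBump η := by
  let φ : ℝ → ℝ := fun s ↦ Real.smoothTransition (4 * (s - 1)) * Real.smoothTransition (4 * (2 - s))
  have hφc : ContDiff ℝ ∞ φ :=
    (Real.smoothTransition.contDiff.comp (by fun_prop)).mul (Real.smoothTransition.contDiff.comp (by fun_prop))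
  have hφ0 : ∀ s, s ≤ 1 → φ s = 0 := fun s hs ↦ by
    have : Real.smoothTransition (4 * (s - 1)) = 0 := Real.smoothTransition.zero_of_nonpos (by linarith)
    simp [φ, this]
  have hφ2 : ∀ s, 2 ≤ s → φ s = 0 := fun s hs ↦ by
    have : Real.smoothTransition (4 * (2 - s)) = 0 := Real.smoothTransition.zero_of_nonpos (by linarith)
    simp [φ, this]
  have hφnn : ∀ s, 0 ≤ φ s := fun s ↦
    mul_nonneg (Real.smoothTransition.nonneg _) (Real.smoothTransition.nonneg _)
  have hφ1 : ∀ s, 5 / 4 < s → s < 7 / 4 → φ s = 1 := fun s h1 h2 ↦ by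
    have ha : Real.smoothTransition (4 * (s - 1)) = 1 := Real.smoothTransition.one_of_one_le (by linarith)
    have hb : Real.smoothTransition (4 * (2 - s)) = 1 := Real.smoothTransition.one_of_one_le (by linarith)
    simp [φ, ha, hb]
  have hsupp : Function.support φ ⊆ Set.Icc 1 2 := by
    intro s hs
    rw [Function.mem_support] at hs
    by_contra h
    rw [Set.mem_Icc, not_and_or, not_le, not_le] at h
    rcases h with h | h
    · exact hs (hφ0 s h.le)
    · exact hs (hφ2 s h.le)
  have hint : Integrable φ :=
    hφc.continuous.integrable_of_hasCompactSupport (HasCompactSupport.of_support_subset_isCompact isCompact_Icc hsupp)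
  have hpos : 0 < ∫ s, φ s := by
    rw [integral_pos_iff_support_of_nonneg hφnn hint]
    have hsub : Set.Ioo (5 / 4 : ℝ) (7 / 4) ⊆ Function.support φ := fun s hs ↦ by
      rw [Function.mem_support, hφ1 s hs.1 hs.2]; exact one_ne_zero
    refine lt_of_lt_of_le ?_ (measure_mono hsub)
    rw [Real.volume_Ioo]
    norm_num
  refine ⟨fun s ↦ (∫ t, φ t)⁻¹ * φ s, contDiff_const.mul hφc, fun s hs ↦ by simp [hφ0 s hs],
    fun s hs ↦ by simp [hφ2 s hs], ?_⟩
  rw [integral_const_mul, inv_mul_cancel₀ hpos.ne']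

/-! ## §1 The hypothesis block of Thm 1.7; the family version -/

/-- **The hypothesis block of Mao–Oh–Tao Thm 1.7** (as vendored in `MaoOhTao.ObstructionFreeAnnularGluing`) for the bump `η`,
thresholds `εo, μo`, in-fields `(gIn, kIn)` read on `A_1`, out-fields `(gOut, kOut)` read on `A_32`, and deviation bounds
`sIn, sOut`: `C² × C¹` smallness on the closed annuli and the five charge inequalities (`Γ = 2`). [folklore] -/
def MOTHyp (η : ℝ → ℝ) (εo μo : ℝ) (gIn kIn gOut kOut : E3 → E3 →L[ℝ] E3 →L[ℝ] ℝ) (sIn sOut : ℝ) : Prop :=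
  DevLE gIn kIn 1 2 sIn ∧ DevLE gOut kOut 32 64 sOut ∧
  letI ΔE := avgE η 32 gOut - avgE η 1 gIn
  letI ΔP := fun i ↦ avgP η 32 kOut i - avgP η 1 kIn i
  letI ΔC := fun i ↦ avgC η 32 gOut i - avgC η 1 gIn i
  letI ΔJ := fun i ↦ avgJ η 32 kOut i - avgJ η 1 kIn i
  Real.sqrt (∑ i, ΔP i ^ 2) < ΔE ∧
  ΔE < 2 * Real.sqrt (ΔE ^ 2 - ∑ i, ΔP i ^ 2) ∧
  ΔE < εo ^ 2 ∧
  Real.sqrt (∑ i, ΔC i ^ 2) + Real.sqrt (∑ i, ΔJ i ^ 2) < μo * ΔE ∧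
  sIn ^ 2 + sOut ^ 2 < μo * ΔE

/-- **Thm 1.7 repackaged**: the vendored fact, with its hypotheses bundled as `MOTHyp`. [cite: MaoOhTao2023, Thm 1.7] -/
theorem mot_apply (hMOT : ObstructionFreeAnnularGluing) {η : ℝ → ℝ} (hη : IsBump η) :
    ∃ εo μo : ℝ, 0 < εo ∧ 0 < μo ∧
      ∀ (Din Dout : InitialDataSet (𝓡 3) E3) (sIn sOut : ℝ),
        Din.VacOn 1 2 → Dout.VacOn 32 64 →
        MOTHyp η εo μo Din.coordH Din.coordK Dout.coordH Dout.coordK sIn sOut →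
        ∃ D : InitialDataSet (𝓡 3) E3,
          D.VacOn 1 64 ∧ (∀ y : E3, ‖y‖ < 2 → D.SameAt Din y) ∧ (∀ y : E3, 32 < ‖y‖ → D.SameAt Dout y) := by
  obtain ⟨εo, μo, hεo, hμo, h⟩ := hMOT η hη
  refine ⟨εo, μo, hεo, hμo, fun Din Dout sIn sOut hvin hvout hH ↦ ?_⟩
  obtain ⟨hdin, hdout, h1, h2, h3, h4, h5⟩ := hH
  exact h Din Dout sIn sOut hvin hvout hdin hdout h1 h2 h3 h4 h5

/-- **Obstruction-free annular gluing, smoothly in a parameter, for the bump `η`** (NOT in print — the route's posited upgrade of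
Mao–Oh–Tao Thm 1.7 / Rem 1.9, which print local LIPSCHITZ dependence of `(g, k)` on the data; the posited statement is
`∀ η, IsBump η → GluingFamilyFor η`): there are thresholds such that, if the in-data `Din t`, `t > t₀`, form a family whose
coefficient fields are jointly `C^∞` in `(t, x)` and satisfy the hypotheses of Thm 1.7 against a fixed out-datum for every `t > t₀`, then
the glued data can be chosen with coefficient fields jointly `C^∞` in `(t, x)`.  (Why plausible: the glued solution is the fixed point of a
contraction that is `C^∞` in `t` with `t`-uniform constants.  Why isolated: it is the only unprinted ingredient of the line.) [folklore] -/
def GluingFamilyFor (η : ℝ → ℝ) : Prop :=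
  ∃ εo μo : ℝ, 0 < εo ∧ 0 < μo ∧
    ∀ (t₀ : ℝ) (Din : ℝ → InitialDataSet (𝓡 3) E3) (Dout : InitialDataSet (𝓡 3) E3) (sIn : ℝ → ℝ) (sOut : ℝ),
      ContDiffOn ℝ ∞ (fun p : ℝ × E3 ↦ (Din p.1).coordH p.2) ({t | t₀ < t} ×ˢ univ) →
      ContDiffOn ℝ ∞ (fun p : ℝ × E3 ↦ (Din p.1).coordK p.2) ({t | t₀ < t} ×ˢ univ) →
      Dout.VacOn 32 64 →
      (∀ t, t₀ < t → (Din t).VacOn 1 2 ∧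
        MOTHyp η εo μo (Din t).coordH (Din t).coordK Dout.coordH Dout.coordK (sIn t) sOut) →
      ∃ D : ℝ → InitialDataSet (𝓡 3) E3,
        ContDiffOn ℝ ∞ (fun p : ℝ × E3 ↦ (D p.1).coordH p.2) ({t | t₀ < t} ×ˢ univ) ∧
        ContDiffOn ℝ ∞ (fun p : ℝ × E3 ↦ (D p.1).coordK p.2) ({t | t₀ < t} ×ˢ univ) ∧
        ∀ t, t₀ < t →
          (D t).VacOn 1 64 ∧ (∀ y : E3, ‖y‖ < 2 → (D t).SameAt (Din t) y) ∧ (∀ y : E3, 32 < ‖y‖ → (D t).SameAt Dout y)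

/-! ## §2 Plumbing statements: affine readings, inverted readings -/

/-- Pointwise vacuum constraints of a datum on `ℝ³` at `y` (under the standing Levi-Civita hypothesis). [folklore] -/
def VacAt (D : InitialDataSet (𝓡 3) E3) (y : E3) : Prop :=
  ∀ [D.metric.HasLeviCivita], D.hamiltonianConstraintFn y = 0 ∧ D.momentumConstraintFn y = 0

/-- **Affine reading and transplanting** of the datum `G` on `ℝ³` at centre `c`, scale `s` and normalisation `τ`: (i) the READING `Gr`
with `h_{Gr}(y) = τ² · h_G(c + s y)`, `k_{Gr}(y) = τ s · k_G(c + s y)` (components on the parallel frame: the pull-back along the affine map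
`y ↦ c + s y` followed by the constant rescaling `(h, k) ↦ (λ² h, λ k)`, `λ = τ/s`, of the space-time metric — both preserve the vacuum
constraints; `τ = 1` is the scale-invariant rescaling of Mao–Oh–Tao (1.2), `τ = s` the pure pull-back) exists as a datum on `ℝ³` and is vacuum
at `y` if `G` is at `c + s y`; (ii) a unit-scale datum `D̂` agreeing with `Gr` outside the ball of radius `a` TRANSPLANTS back: there is `G′` with
`τ² · h_{G′}(c + s y) = h_{D̂}(y)`, `τ s · k_{G′}(c + s y) = k_{D̂}(y)`, equal to `G` outside the ball of radius `a s` about `c`, vacuum at `c + s y`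
if `D̂` is at `y`.  (Used as `∀ G c s τ, 0 < s → 0 < τ → ReadTransplantAt G c s τ`.) [folklore] -/
def ReadTransplantAt (G : InitialDataSet (𝓡 3) E3) (c : E3) (s τ : ℝ) : Prop :=
  ∃ Gr : InitialDataSet (𝓡 3) E3,
    (∀ y v w : E3, Gr.h.inner y v w = τ ^ 2 * G.h.inner (c + s • y) v w ∧
      Gr.k y v w = (τ * s) * G.k (c + s • y) v w) ∧
    (∀ y : E3, VacAt G (c + s • y) → VacAt Gr y) ∧
    ∀ (Dhat : InitialDataSet (𝓡 3) E3) (a : ℝ), 0 < a →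
      (∀ y : E3, a < ‖y‖ → Dhat.SameAt Gr y) →
      ∃ G' : InitialDataSet (𝓡 3) E3,
        (∀ y v w : E3, τ ^ 2 * G'.h.inner (c + s • y) v w = Dhat.h.inner y v w ∧
          (τ * s) * G'.k (c + s • y) v w = Dhat.k y v w) ∧
        (∀ y : E3, a * s < ‖y - c‖ → G'.SameAt G y) ∧
        (∀ y : E3, VacAt Dhat y → VacAt G' (c + s • y))

/-- The sheet-2 inversion at depth `ρ₃`: `x ↦ (ρ₃/|x|²) x` (an involution of `ℝ³ ∖ {0}`; with `X₃ ρ₃ = (M/2)²` it is, after the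
dilation by `X₃`, the inversion `y = (M/2)² x/|x|²` in the throat sphere, an isometry of `(1 + M/2|y|)⁴ δ`). [folklore] -/
def inv (ρ₃ : ℝ) (x : E3) : E3 := (ρ₃ / ‖x‖ ^ 2) • x

/-- The INVERTED READING of the metric of `G` at depth `ρ₃` and scale `X₃`: `x ↦ X₃⁻² · (inv^* h_G)_x` on the parallel frame
(the scale-invariant rescaling of the pull-back along `inv ρ₃`). [folklore] -/
def invReadH (G : InitialDataSet (𝓡 3) E3) (ρ₃ X₃ : ℝ) (x : E3) : E3 →L[ℝ] E3 →L[ℝ] ℝ :=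
  (X₃ ^ 2)⁻¹ • (G.coordH (inv ρ₃ x)).bilinearComp (fderiv ℝ (inv ρ₃) x) (fderiv ℝ (inv ρ₃) x)

/-- The INVERTED READING of the second fundamental form of `G`: `x ↦ X₃⁻¹ · (inv^* k_G)_x`. [folklore] -/
def invReadK (G : InitialDataSet (𝓡 3) E3) (ρ₃ X₃ : ℝ) (x : E3) : E3 →L[ℝ] E3 →L[ℝ] ℝ :=
  X₃⁻¹ • (G.coordK (inv ρ₃ x)).bilinearComp (fderiv ℝ (inv ρ₃) x) (fderiv ℝ (inv ρ₃) x)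

/-- **Capping the end through the inversion chart**, for `M, ρ₃, X₃` (intended `X₃ ρ₃ = (M/2)²`) and a datum `G` on `ℝ³` (the
`y`-chart): (i) there is a datum `Ĝ` on `ℝ³` (the `x`-chart) whose coefficient fields ARE the inverted readings `invReadH/invReadK` on
`{|x| > 1/4}`, vacuum at such `x` when `G` is at `inv ρ₃ x`; (ii) every unit-scale datum `D̂` which agrees with `Ĝ` outside the ball of radius
`32` and is the exact sheet-2 far field `((1 + M/(2 X₃ |x|))⁴ δ, 0)` on `{1/4 < |x| < 2}` transplants back to a datum `P` on the `y`-chart which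
is exactly `((1 + M/2|y|)⁴ δ, 0)` on `{|y| > ρ₃/2}` (Kelvin: the inversion is an isometry of isotropic Schwarzschild), equals `G` inside the
ball of radius `ρ₃/32`, and is vacuum on `{|y| > ρ₃/2}`, at `y` with `ρ₃/64 < |y| < 2ρ₃` when `D̂` is at `inv ρ₃ y`, and at `|y| < ρ₃/32`
when `G` is.  (Used as `∀ M ρ₃ X₃, 0 < M → 0 < ρ₃ → 0 < X₃ → X₃ ρ₃ = (M/2)² → ∀ G, CapEndAt M ρ₃ X₃ G`.) [folklore] -/
def CapEndAt (M ρ₃ X₃ : ℝ) (G : InitialDataSet (𝓡 3) E3) : Prop :=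
  ∃ Ghat : InitialDataSet (𝓡 3) E3,
    (∀ x : E3, 1 / 4 < ‖x‖ → Ghat.coordH x = invReadH G ρ₃ X₃ x ∧ Ghat.coordK x = invReadK G ρ₃ X₃ x) ∧
    (∀ x : E3, 1 / 4 < ‖x‖ → VacAt G (inv ρ₃ x) → VacAt Ghat x) ∧
    ∀ Dhat : InitialDataSet (𝓡 3) E3,
      (∀ x : E3, 32 < ‖x‖ → Dhat.SameAt Ghat x) →
      (∀ x : E3, 1 / 4 < ‖x‖ → ‖x‖ < 2 →
        (∀ v w : E3, Dhat.h.inner x v w = (1 + M / (2 * X₃ * ‖x‖)) ^ 4 * ⟪v, w⟫_ℝ) ∧ Dhat.k x = 0) →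
      ∃ P : InitialDataSet (𝓡 3) E3,
        (∀ y : E3, ρ₃ / 2 < ‖y‖ →
          (∀ v w : E3, P.h.inner y v w = Schwarzschild.conformalFactor M y ^ 4 * ⟪v, w⟫_ℝ) ∧ P.k y = 0) ∧
        (∀ y : E3, ‖y‖ < ρ₃ / 32 → P.SameAt G y) ∧
        (∀ y : E3, ρ₃ / 2 < ‖y‖ → VacAt P y) ∧
        (∀ y : E3, ρ₃ / 64 < ‖y‖ → ‖y‖ < 2 * ρ₃ → VacAt Dhat (inv ρ₃ y) → VacAt P y) ∧
        (∀ y : E3, ‖y‖ < ρ₃ / 32 → VacAt G y → VacAt P y)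

/-! ## §3 Explicit-field statements -/

/-- The exact isotropic Schwarzschild(`m`) metric field `(1 + m/2|y|)⁴ δ` on the parallel frame. [folklore] -/
def schwField (m : ℝ) (y : E3) : E3 →L[ℝ] E3 →L[ℝ] ℝ :=
  (1 + m / (2 * ‖y‖)) ^ 4 • (innerSL ℝ : E3 →L[ℝ] E3 →L[ℝ] ℝ)

/-- The flat metric field `δ`. [folklore] -/
def flatField : E3 → E3 →L[ℝ] E3 →L[ℝ] ℝ := fun _ ↦ (innerSL ℝ : E3 →L[ℝ] E3 →L[ℝ] ℝ)

/-- The zero field (time symmetry `k = 0`). [folklore] -/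
def zeroField : E3 → E3 →L[ℝ] E3 →L[ℝ] ℝ := fun _ ↦ 0

/-- `F` is the flat vacuum datum `(δ, 0)` on `ℝ³`. [folklore] -/
def FlatVacuumDatum (F : InitialDataSet (𝓡 3) E3) : Prop :=
  (∀ y v w : E3, F.h.inner y v w = ⟪v, w⟫_ℝ ∧ F.k y = 0) ∧ ∀ y : E3, VacAt F y

/-- `S` is a smooth datum on `ℝ³` which is exactly time-symmetric isotropic Schwarzschild(`m`) `((1 + m/2|y|)⁴ δ, 0)` and vacuum off the
ball of radius `1/4` (a smoothing of the puncture). [folklore] -/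
def SchwDatum (m : ℝ) (S : InitialDataSet (𝓡 3) E3) : Prop :=
  (∀ y : E3, 1 / 4 < ‖y‖ → (∀ v w : E3, S.h.inner y v w = (1 + m / (2 * ‖y‖)) ^ 4 * ⟪v, w⟫_ℝ) ∧ S.k y = 0) ∧
  (∀ y : E3, 1 / 4 < ‖y‖ → VacAt S y)

/-- **The exact Schwarzschild(`m`) far field as an OUT-site against a nearly flat core** (the setting of Mao–Oh–Tao Rem 1.11), for the
bump `η`, thresholds `εo, μo`, deviation bound `sOut` and margin `θ`: for EVERY datum `S` with `SchwDatum m S` the Thm-1.7 hypothesis block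
holds for OUT = `S` against ANY in-fields of deviation and charges at most `θ` (the flat core has them `0`; a receding far field of an
admissible datum has them eventually `≤ θ`).  (Used as `∀ η, IsBump η → ∀ εo μo μ₀ > 0, ∃ m sOut θ, 0 < m ≤ μ₀ ∧ 0 < θ ∧
SchwOutSite η εo μo m sOut θ`.) [folklore] -/
def SchwOutSite (η : ℝ → ℝ) (εo μo m sOut θ : ℝ) : Prop :=
  ∀ S : InitialDataSet (𝓡 3) E3, SchwDatum m S →
    ∀ (gIn kIn : E3 → E3 →L[ℝ] E3 →L[ℝ] ℝ) (sIn : ℝ),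
      DevLE gIn kIn 1 2 sIn → 0 ≤ sIn → sIn ≤ θ → |avgE η 1 gIn| ≤ θ → (∀ i, |avgP η 1 kIn i| ≤ θ) →
      (∀ i, |avgC η 1 gIn i| ≤ θ) → (∀ i, |avgJ η 1 kIn i| ≤ θ) →
      MOTHyp η εo μo gIn kIn S.coordH S.coordK sIn sOut

/-- **The Brill–Lindquist bulk and its sites** (explicit), for the bump `η`, thresholds `εo, μo`, a mass `M` and a core mass `μ′`: there are
a depth `0 < ρ₃ < M/40` with `X₃ ρ₃ = (M/2)²`, finitely many puncture sites `(c_j, s_j)` (`c_0 = 0`) whose gluing balls `B(c_j, 64 s_j)` lie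
inside `{|y| < ρ₃/256}` and are well separated (`|c_i − c_j| > 160(s_i + s_j)`), and a smooth time-symmetric datum `B` on `ℝ³` (the
conformally flat `(A + Σ_j α_j/|y − c_j|)⁴ δ` with the punctures smoothed inside `B(c_j, s_j)`), vacuum off the balls `B(c_j, s_j)`, such
that: every puncture `j ≠ 0` is a Thm-1.7 OUT-site (PURE PULL-BACK reading at `(c_j, s_j)`: fields `s_j² h_B(c_j + s_j y)`) against the flat
IN-core; the central puncture is an OUT-site against the exact Schwarzschild(`μ′/64`) IN-core `(1 + μ′/128|y|)⁴ δ`; and the inverted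
reading at depth `ρ₃`, scale `X₃` is an OUT-site against the sheet-2 far field `(1 + M/(2X₃|x|))⁴ δ` of Schwarzschild(`M`) as IN-data.
(Used as `∀ η, IsBump η → ∀ εo μo M μ′ > 0, BulkAt η εo μo M μ′`.) [folklore] -/
def BulkAt (η : ℝ → ℝ) (εo μo M μ' : ℝ) : Prop :=
  ∃ (ρ₃ X₃ : ℝ) (N : ℕ) (c : Fin (N + 1) → E3) (s sOut : Fin (N + 1) → ℝ) (sIn₀ sM sEnd : ℝ)
    (B : InitialDataSet (𝓡 3) E3),
    0 < ρ₃ ∧ ρ₃ < M / 40 ∧ 0 < X₃ ∧ X₃ * ρ₃ = (M / 2) ^ 2 ∧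
    c 0 = 0 ∧ (∀ j, 0 < s j) ∧ (∀ j, ‖c j‖ + 64 * s j < ρ₃ / 256) ∧
    (∀ i j, i ≠ j → 160 * s i + 160 * s j < ‖c i - c j‖) ∧
    (∀ y : E3, B.k y = 0) ∧
    (∀ y : E3, (∀ j, s j ≤ ‖y - c j‖) → VacAt B y) ∧
    (∀ j, j ≠ 0 →
      MOTHyp η εo μo flatField zeroField (fun y ↦ (s j) ^ 2 • B.coordH (c j + s j • y))
        (fun y ↦ (s j) ^ 2 • B.coordK (c j + s j • y)) 0 (sOut j)) ∧
    DevLE (schwField (μ' / 64)) zeroField 1 2 sIn₀ ∧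
    MOTHyp η εo μo (schwField (μ' / 64)) zeroField (fun y ↦ (s 0) ^ 2 • B.coordH (c 0 + s 0 • y))
      (fun y ↦ (s 0) ^ 2 • B.coordK (c 0 + s 0 • y)) sIn₀ (sOut 0) ∧
    DevLE (schwField (M / X₃)) zeroField 1 2 sM ∧
    MOTHyp η εo μo (schwField (M / X₃)) zeroField (invReadH B ρ₃ X₃) (invReadK B ρ₃ X₃) sM sEnd

/-! ## §4 PlugData⁺ -/

/-- **PlugData⁺ at compactness bound `μ₀`**: there are a mass `M > 0`, a depth `0 < ρ₃ < M/40`, a scale `λ` with `2λ < ρ₃`, a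
compactness `0 < μ ≤ μ₀` and a smooth datum `D₀` on `ℝ³` solving the vacuum constraints EVERYWHERE which is exactly time-symmetric
isotropic Schwarzschild(`M`) `((1 + M/2|y|)⁴ δ, 0)` on `{|y| > ρ₃}` (the sibling crux's PlugData, item 10055) and exactly the CONSTANT MULTIPLE
`λ⁻²` of time-symmetric isotropic Schwarzschild(`λμ`) `(λ⁻²(1 + λμ/2|y|)⁴ δ, 0)` on the annulus `{λ < |y| < 2λ}` (so that its pure pull-back
along `y ↦ λ y` is `((1 + μ/2|y|)⁴ δ, 0)` on `{1 < |y| < 2}`).  (Used as `∀ μ₀ > 0, PlugDataPlusAt μ₀`.) [folklore] -/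
def PlugDataPlusAt (μ₀ : ℝ) : Prop :=
  ∃ (μ M ρ₃ lam : ℝ) (D₀ : InitialDataSet (𝓡 3) E3),
    0 < μ ∧ μ ≤ μ₀ ∧ 0 < M ∧ 0 < ρ₃ ∧ ρ₃ < M / 40 ∧ 0 < lam ∧ 2 * lam < ρ₃ ∧
    (∀ [D₀.metric.HasLeviCivita], D₀.IsVacuumConstraintSolution) ∧
    (∀ y : E3, ρ₃ < ‖y‖ →
      (∀ v w : E3, D₀.h.inner y v w = Schwarzschild.conformalFactor M y ^ 4 * ⟪v, w⟫_ℝ) ∧ D₀.k y = 0) ∧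
    (∀ y : E3, lam < ‖y‖ → ‖y‖ < 2 * lam →
      (∀ v w : E3, D₀.h.inner y v w = (lam ^ 2)⁻¹ * (1 + lam * μ / (2 * ‖y‖)) ^ 4 * ⟪v, w⟫_ℝ) ∧ D₀.k y = 0)

/-! ## §5 Appendix (2026-08-16, line `Sketch` of the sibling crux 10051): the inversion fixes the origin -/

/-- The sheet-2 inversion fixes the (junk) origin: `inv ρ₃ 0 = 0` (`ρ₃/0 = 0`), so that
`inv ρ₃ ∘ inv ρ₃ = id` on ALL of `ℝ³` once `ρ₃ ≠ 0`. [folklore] -/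
theorem inv_apply_zero (ρ₃ : ℝ) : inv ρ₃ 0 = 0 := by
  simp [inv]

end Summit.FinalStateConjecture.FinalStateConjecture.Theorems.SwallowTheDatum.ParametricKerrBurial

end
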